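import Summits.RiemannHypothesis.RiemannHypothesis.Theorems.WeilGroundStateGroundStateSimpleEvenIncrementSplit
import Literature.NumberTheory.LFunctions.WeilArchDensityPanelTM
import HarnessLib

/-!
# RiemannHypothesis / GroundBarta — rung 4 (`EvenWinsBeyondArch`, stmt-RiemannHypothesis-18807 / 18085):
# the deflated Temple L-side, A-layer III — the pole form of a scaled window polynomial, exactly and certified

Helper file (`--supports`), RH-free, no definitions, no named facts.  Prover A, speedrun unit `sr-gb-rung-a` (gen 2).

For `v(x) = 𝟙_{[-b,b]}(x) P(x/b)` (`P : Poly`, rational `b > 0`): `P(v) = 2‖∫ v cosh(x/2)‖² − 2‖∫ v sinh(x/2)‖²` with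
`∫ v cosh(x/2) dx = b ∫_{-1}^{1} P(y) cosh(by/2) dy`, and the exponential integrals are EXACT:
`J±(P, b) = ∫_{-1}^{1} P(y) e^{±by/2} dy = A±(1) e^{±b/2} − A±(−1) e^{∓b/2}`, `A± = Poly.ad (±b/2) P`
(`ExpPoly.Poly.hasDerivAt_ad`).  So `P(v) = 2b² [((J₊+J₋)/2)² − ((J₊−J₋)/2)²] = 2 b² J₊ J₋`
(`dt_weilPoleForm_windowPolyY_eq`), and with `MI.expPt` enclosures of `e^{±b/2}` a kernel check `poleCheckY` encloses it
(`dt_weilPoleForm_windowPolyY_mem`).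

References: H. Yoshida, *On Hermitian forms attached to zeta functions*, §6 eq. (6.2) [Yoshida1992].
-/

set_option linter.dupNamespace false

noncomputable section

open MeasureTheory Set intervalIntegral
open scoped BigOperators

namespace Summit.RiemannHypothesis.RiemannHypothesis.Theorems.EvenWinsBeyondArch

open Literature.NumberTheory.LFunctions Literature.Analysis.ValidatedNumerics.ExpPoly
open Literature.Analysis.ValidatedNumerics.PolyMP Literature.Analysis.ValidatedNumerics.NumericsMP

/-- The exact exponential moment `J_κ(P) = ∫_{-1}^{1} P(y) e^{κy} dy = A(1)e^{κ} − A(−1)e^{−κ}`, `A = ad κ P`. [folklore] -/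
theorem dt_integral_poly_mul_exp_unit (P : Poly) (κ : ℚ) :
    ∫ y in (-1 : ℝ)..1, Poly.eval P y * Real.exp ((κ : ℝ) * y) =
      Poly.eval (Poly.ad κ P) 1 * Real.exp (κ : ℝ) - Poly.eval (Poly.ad κ P) (-1) * Real.exp (-(κ : ℝ)) := by
  have h := fun x (_ : x ∈ uIcc (-1 : ℝ) 1) ↦ Poly.hasDerivAt_ad κ 0 P x
  simp only [Rat.cast_zero, add_zero] at h
  rw [integral_eq_sub_of_hasDerivAt h (((Poly.continuous_eval P).mul (by fun_prop)).intervalIntegrable _ _)]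
  simp

/-- The window integrals against `cosh(x/2)`, `sinh(x/2)` through `J±`:
`∫ v(x) cosh(x/2) dx = b (J₊ + J₋)/2`, `∫ v(x) sinh(x/2) dx = b (J₊ − J₋)/2`. [folklore] -/
theorem dt_window_cosh_sinh_eq (P : Poly) {b : ℚ} (hb : 0 < b) :
    (∫ x, (((Set.Icc (-(b : ℝ)) b).indicator (fun x ↦ Poly.eval P (x / b)) x : ℝ) : ℂ) * (Real.cosh (x / 2) : ℂ)) =
        (((b : ℝ) * ((∫ y in (-1 : ℝ)..1, Poly.eval P y * Real.exp (((b / 2 : ℚ) : ℝ) * y)) +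
          (∫ y in (-1 : ℝ)..1, Poly.eval P y * Real.exp (((-(b / 2) : ℚ) : ℝ) * y))) / 2 : ℝ) : ℂ) ∧
      (∫ x, (((Set.Icc (-(b : ℝ)) b).indicator (fun x ↦ Poly.eval P (x / b)) x : ℝ) : ℂ) * (Real.sinh (x / 2) : ℂ)) =
        (((b : ℝ) * ((∫ y in (-1 : ℝ)..1, Poly.eval P y * Real.exp (((b / 2 : ℚ) : ℝ) * y)) -
          (∫ y in (-1 : ℝ)..1, Poly.eval P y * Real.exp (((-(b / 2) : ℚ) : ℝ) * y))) / 2 : ℝ) : ℂ) := by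
  have hbr : (0 : ℝ) < b := by exact_mod_cast hb
  have hb0 : (b : ℝ) ≠ 0 := hbr.ne'
  -- reduce a complex window integral with a continuous real weight to a real interval integral
  have key : ∀ (w : ℝ → ℝ), Continuous w →
      (∫ x, (((Set.Icc (-(b : ℝ)) b).indicator (fun x ↦ Poly.eval P (x / b)) x : ℝ) : ℂ) * (w x : ℂ)) =
        ((∫ x in (-(b : ℝ))..b, Poly.eval P (x / b) * w x : ℝ) : ℂ) := by
    intro w hw
    have h1 : (∫ x, (((Set.Icc (-(b : ℝ)) b).indicator (fun x ↦ Poly.eval P (x / b)) x : ℝ) : ℂ) * (w x : ℂ)) =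
        ((∫ x, (Set.Icc (-(b : ℝ)) b).indicator (fun x ↦ Poly.eval P (x / b) * w x) x : ℝ) : ℂ) := by
      rw [← integral_complex_ofReal]
      congr 1 with x
      by_cases hx : x ∈ Set.Icc (-(b : ℝ)) b
      · rw [indicator_of_mem hx, indicator_of_mem hx]; push_cast; ring
      · rw [indicator_of_notMem hx, indicator_of_notMem hx]; push_cast; ring
    rw [h1, MeasureTheory.integral_indicator measurableSet_Icc, integral_Icc_eq_integral_Ioc,
      ← intervalIntegral.integral_of_le (by linarith)]
  -- substitution `x = b y`
  have sub : ∀ (w : ℝ → ℝ), ∫ x in (-(b : ℝ))..b, Poly.eval P (x / b) * w x =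
      (b : ℝ) * ∫ y in (-1 : ℝ)..1, Poly.eval P y * w (b * y) := by
    intro w
    have h := intervalIntegral.integral_comp_div (fun y ↦ Poly.eval P y * w (b * y)) hb0 (a := -(b : ℝ)) (b := (b : ℝ))
    have e : ∀ x : ℝ, Poly.eval P (x / b) * w (b * (x / b)) = Poly.eval P (x / b) * w x := by
      intro x; rw [mul_div_cancel₀ x hb0]
    simp_rw [e] at h
    rw [h, neg_div, div_self hb0, smul_eq_mul]
  have hcosh : ∀ y : ℝ, Real.cosh (b * y / 2) = (Real.exp (((b / 2 : ℚ) : ℝ) * y) + Real.exp (((-(b / 2) : ℚ) : ℝ) * y)) / 2 := by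
    intro y; rw [Real.cosh_eq]; push_cast; ring_nf
  have hsinh : ∀ y : ℝ, Real.sinh (b * y / 2) = (Real.exp (((b / 2 : ℚ) : ℝ) * y) - Real.exp (((-(b / 2) : ℚ) : ℝ) * y)) / 2 := by
    intro y; rw [Real.sinh_eq]; push_cast; ring_nf
  have hI1 : IntervalIntegrable (fun y ↦ Poly.eval P y * Real.exp (((b / 2 : ℚ) : ℝ) * y)) volume (-1 : ℝ) 1 :=
    ((Poly.continuous_eval P).mul (by fun_prop)).intervalIntegrable _ _
  have hI2 : IntervalIntegrable (fun y ↦ Poly.eval P y * Real.exp (((-(b / 2) : ℚ) : ℝ) * y)) volume (-1 : ℝ) 1 :=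
    ((Poly.continuous_eval P).mul (by fun_prop)).intervalIntegrable _ _
  constructor
  · rw [key _ (by fun_prop), sub]
    congr 1
    have e : ∀ y : ℝ, Poly.eval P y * Real.cosh (b * y / 2) =
        (Poly.eval P y * Real.exp (((b / 2 : ℚ) : ℝ) * y) + Poly.eval P y * Real.exp (((-(b / 2) : ℚ) : ℝ) * y)) / 2 := by
      intro y; rw [hcosh]; ring
    simp_rw [e, intervalIntegral.integral_div, intervalIntegral.integral_add hI1 hI2]
    ring
  · rw [key _ (by fun_prop), sub]
    congr 1
    have e : ∀ y : ℝ, Poly.eval P y * Real.sinh (b * y / 2) =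
        (Poly.eval P y * Real.exp (((b / 2 : ℚ) : ℝ) * y) - Poly.eval P y * Real.exp (((-(b / 2) : ℚ) : ℝ) * y)) / 2 := by
      intro y; rw [hsinh]; ring
    simp_rw [e, intervalIntegral.integral_div, intervalIntegral.integral_sub hI1 hI2]
    ring

/-- **The pole form of a scaled window polynomial**: `P(v) = 2 b² J₊ J₋`,
`J± = A±(1) e^{±b/2} − A±(−1) e^{∓b/2}`, `A± = ad(±b/2) P`. [cite: Yoshida1992, §6 eq. (6.2)] -/
theorem dt_weilPoleForm_windowPolyY_eq (P : Poly) {b : ℚ} (hb : 0 < b) :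
    weilPoleForm (fun x : ℝ ↦ (((Set.Icc (-(b : ℝ)) b).indicator (fun x ↦ Poly.eval P (x / b)) x : ℝ) : ℂ)) =
      2 * (b : ℝ) ^ 2 *
        ((Poly.eval (Poly.ad (b / 2) P) 1 * Real.exp ((b / 2 : ℚ) : ℝ) -
            Poly.eval (Poly.ad (b / 2) P) (-1) * Real.exp (-((b / 2 : ℚ) : ℝ))) *
          (Poly.eval (Poly.ad (-(b / 2)) P) 1 * Real.exp ((-(b / 2) : ℚ) : ℝ) -
            Poly.eval (Poly.ad (-(b / 2)) P) (-1) * Real.exp (-((-(b / 2) : ℚ) : ℝ)))) := by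
  obtain ⟨hc, hs⟩ := dt_window_cosh_sinh_eq P hb
  unfold weilPoleForm
  rw [hc, hs, Complex.norm_real, Complex.norm_real, Real.norm_eq_abs, Real.norm_eq_abs, sq_abs, sq_abs,
    dt_integral_poly_mul_exp_unit, dt_integral_poly_mul_exp_unit]
  ring

/-- The kernel enclosure of the pole form: exact rational parts `A±(±1)` and `MI.expPt` enclosures of `e^{±b/2}`, combined
by interval arithmetic at scale `S`. [folklore] -/
def poleBoundsY (S Ke ke : ℕ) (P : Poly) (b : ℚ) : ℤ × ℤ :=
  let Ep : MI := expRatMI S Ke ke (b / 2)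
  let Em : MI := expRatMI S Ke ke (-(b / 2))
  let a1 : ℚ := Poly.evalQ (Poly.ad (b / 2) P) 1
  let a2 : ℚ := Poly.evalQ (Poly.ad (b / 2) P) (-1)
  let c1 : ℚ := Poly.evalQ (Poly.ad (-(b / 2)) P) 1
  let c2 : ℚ := Poly.evalQ (Poly.ad (-(b / 2)) P) (-1)
  let Jp : MI := MI.sub (MI.mul S (ofRat S a1) Ep) (MI.mul S (ofRat S a2) Em)
  let Jm : MI := MI.sub (MI.mul S (ofRat S c1) Em) (MI.mul S (ofRat S c2) Ep)
  let R : MI := MI.mul S (ofRat S (2 * b ^ 2)) (MI.mul S Jp Jm)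
  (R.lo, R.hi)

/-- Success of the two exponential enclosures. [folklore] -/
def poleCheckY (S Ke ke : ℕ) (b : ℚ) : Bool :=
  (MI.expPt S Ke ke (ofRat S (b / 2))).isSome && (MI.expPt S Ke ke (ofRat S (-(b / 2)))).isSome

/-- **Kernel-certified enclosure of the pole form of a scaled window polynomial.** [cite: Yoshida1992, §6 eq. (6.2)] -/
theorem dt_weilPoleForm_windowPolyY_mem (P : Poly) {b : ℚ} (hb : 0 < b) {S : ℕ} (hS : 0 < S) {Ke ke : ℕ}
    (hchk : poleCheckY S Ke ke b = true) :
    (((poleBoundsY S Ke ke P b).1 : ℝ)) / S ≤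
        weilPoleForm (fun x : ℝ ↦ (((Set.Icc (-(b : ℝ)) b).indicator (fun x ↦ Poly.eval P (x / b)) x : ℝ) : ℂ)) ∧
      weilPoleForm (fun x : ℝ ↦ (((Set.Icc (-(b : ℝ)) b).indicator (fun x ↦ Poly.eval P (x / b)) x : ℝ) : ℂ)) ≤
        (((poleBoundsY S Ke ke P b).2 : ℝ)) / S := by
  unfold poleCheckY at hchk
  simp only [Bool.and_eq_true] at hchk
  obtain ⟨h1, h2⟩ := hchk
  have hEp := mem_expRatMI hS h1
  have hEm := mem_expRatMI hS h2
  rw [dt_weilPoleForm_windowPolyY_eq P hb]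
  have ha1 := mem_ofRat S (Poly.evalQ (Poly.ad (b / 2) P) 1)
  have ha2 := mem_ofRat S (Poly.evalQ (Poly.ad (b / 2) P) (-1))
  have hc1 := mem_ofRat S (Poly.evalQ (Poly.ad (-(b / 2)) P) 1)
  have hc2 := mem_ofRat S (Poly.evalQ (Poly.ad (-(b / 2)) P) (-1))
  have h2b := mem_ofRat S (2 * b ^ 2)
  rw [Poly.eval_evalQ] at ha1 ha2 hc1 hc2
  push_cast at ha1 ha2 hc1 hc2 h2b
  have hJp := MI.mem_sub (MI.mem_mul hS ha1 hEp) (MI.mem_mul hS ha2 hEm)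
  have hJm := MI.mem_sub (MI.mem_mul hS hc1 hEm) (MI.mem_mul hS hc2 hEp)
  have hR := MI.mem_mul hS h2b (MI.mem_mul hS hJp hJm)
  obtain ⟨hlo, hhi⟩ := hR
  have hSr : (0 : ℝ) < S := by exact_mod_cast hS
  have e1 : Real.exp (-((-(b / 2) : ℚ) : ℝ)) = Real.exp (((b / 2 : ℚ) : ℝ)) := by push_cast; ring_nf
  have e2 : Real.exp (-((b / 2 : ℚ) : ℝ)) = Real.exp (((-(b / 2) : ℚ) : ℝ)) := by push_cast; ring_nf
  rw [e1, e2]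
  unfold poleBoundsY
  simp only []
  constructor
  · rw [div_le_iff₀ hSr]
    refine le_trans hlo (le_of_eq ?_)
    push_cast; ring
  · rw [le_div_iff₀ hSr]
    refine le_trans (le_of_eq ?_) hhi
    push_cast; ring

end Summit.RiemannHypothesis.RiemannHypothesis.Theorems.EvenWinsBeyondArch

end
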